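import Summits.AtomisticToContinuum.HydrodynamicLimit.Theorems.CollisionIsometryCLTCollisionalTransferLocalityFlowMeasurable
import Summits.AtomisticToContinuum.HydrodynamicLimit.Theorems.CollisionIsometryCLTCollisionalTransferLocalityBlockFields
import Summits.AtomisticToContinuum.HydrodynamicLimit.Theorems.JParityClosureOddContactSymmetryGibbsInvariance
import HarnessLib

/-!
# [KF-int] Fast moment relaxation at global equilibrium from the block dominators
(stub `stub_fmrConst_of_dominators`, line `hemisphere-affine-slaving`, crux `CollisionalTransferLocality`,
stmt-AtomisticToContinuum-9518)

Supporting file (`--supports stmt-AtomisticToContinuum-9518`) proving the registered glue stub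
[KF-int] VERBATIM: the kinetic closure `FastMomentRelaxation` (route item 9522) AT GLOBAL EQUILIBRIUM
— under the homogeneous local Gibbs law `G_N = localGibbsLaw σ 1 0 θ N (Φ N)` and for EVERY flow
family `Φ` — follows from
* [KS-D'] `E_N ∫⁻ₓ ofReal (A + B) → 0`, `A = Σ_jk ⟨φ (v_j v_k − θ δ_jk)⟩²`, `B = |m̄|² Ē/ρ̄`;
* [KS-q'] `E_N ∫⁻ₓ ofReal (T + B₂) → 0`, `T = Σ_a ⟨φ |v|² v_a⟩²`, `B₂ = |m̄|² (Ē/ρ̄)²`;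
* [KF-dom] the pointwise domination `Σ D² + |q|² ≤ 2A + 4B + T/2 + 50 B₂` for `φ ≥ 0`,
all three taken as HYPOTHESES (they are the neighbouring stubs of the wave).

Proof, entirely in `ℝ≥0∞` (no Bochner integrability is ever needed):
(i) `ofReal (∫_{[0,t]} ∫ₓ F) ≤ ∫⁻_{[0,t]} ∫⁻ₓ ofReal F` for the nonnegative integrand
`F = Σ D² + |q|²` (`‖∫ f‖ₑ ≤ ∫⁻ ‖f‖ₑ`, valid even for junk Bochner integrals);
(ii) pointwise `ofReal F ≤ 4 ofReal (A + B) + 50 ofReal (T + B₂)`, whence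
`∫⁻ₓ ofReal F ≤ K(w) := 4 ∫⁻ₓ ofReal (A + B) + 50 ∫⁻ₓ ofReal (T + B₂)`;
(iii) Markov off the null bad set of the flow, through the jointly measurable modification of the
flow (`exists_measurable_flow`); (iv) Tonelli in `(z, s)`; (v) stationarity of the homogeneous law
under every hard-sphere flow (`lintegral_comp_flow_localGibbsLaw_const`), so that
`G_N {δ < ∫_{[0,t]} ∫ₓ F(Φ_s z, x)} ≤ t · (4 E_N ∫⁻ₓ(A+B) + 50 E_N ∫⁻ₓ(T+B₂)) / δ → 0`.
Everything is folklore measure theory; no definitions, no new named facts; axioms `propext`,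
`Classical.choice`, `Quot.sound`.
-/

namespace Summit.AtomisticToContinuum.HydrodynamicLimit.Theorems.HemisphereAffineSlaving

open scoped BigOperators Topology Classical ENNReal InnerProductSpace
open Filter Set Function MeasureTheory

noncomputable section

open Literature.MathematicalPhysics.KineticTheory (T3 V3)
open Literature.MathematicalPhysics.KineticTheory (localGibbsLaw isProbabilityMeasure_localGibbsLaw)

/-! ## Elementary inequalities -/

/-- `ofReal (∫ f) ≤ ∫⁻ ofReal f` for a pointwise nonnegative real integrand, with NO integrability
assumption (a junk Bochner integral is `0`). [folklore] -/
private theorem ofReal_integral_le_lintegral_ofReal_of_nonneg {α : Type*} [MeasurableSpace α]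
    {μ : Measure α} {f : α → ℝ} (hf : ∀ a, 0 ≤ f a) :
    ENNReal.ofReal (∫ a, f a ∂μ) ≤ ∫⁻ a, ENNReal.ofReal (f a) ∂μ :=
  calc ENNReal.ofReal (∫ a, f a ∂μ) ≤ ‖∫ a, f a ∂μ‖ₑ := Real.ofReal_le_enorm _
    _ ≤ ∫⁻ a, ‖f a‖ₑ ∂μ := enorm_integral_le_lintegral_enorm _
    _ = ∫⁻ a, ENNReal.ofReal (f a) ∂μ := lintegral_congr fun a => Real.enorm_eq_ofReal (hf a)

/-- If `F ≤ 2A + 4B + T/2 + 50 B₂` with `A, T ≥ 0` then, in `ℝ≥0∞`,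
`ofReal F ≤ 4 ofReal (A + B) + 50 ofReal (T + B₂)`. [folklore] -/
private theorem ofReal_le_of_dominators {F A B T B₂ : ℝ}
    (h : F ≤ 2 * A + 4 * B + 1 / 2 * T + 50 * B₂) (hA : 0 ≤ A) (hT : 0 ≤ T) :
    ENNReal.ofReal F ≤ 4 * ENNReal.ofReal (A + B) + 50 * ENNReal.ofReal (T + B₂) := by
  have hle : F ≤ 4 * (A + B) + 50 * (T + B₂) := by linarith
  calc ENNReal.ofReal F ≤ ENNReal.ofReal (4 * (A + B) + 50 * (T + B₂)) :=
        ENNReal.ofReal_le_ofReal hle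
    _ ≤ ENNReal.ofReal (4 * (A + B)) + ENNReal.ofReal (50 * (T + B₂)) := ENNReal.ofReal_add_le
    _ = 4 * ENNReal.ofReal (A + B) + 50 * ENNReal.ofReal (T + B₂) := by
        rw [ENNReal.ofReal_mul (by norm_num), ENNReal.ofReal_mul (by norm_num),
          ENNReal.ofReal_ofNat, ENNReal.ofReal_ofNat]

/-- Monotonicity of a measure along an inclusion that holds on a conull set `g`:
if `μ gᶜ = 0` and `s ∩ g ⊆ t`, then `μ s ≤ μ t`. [folklore] -/
-- adapted from …Theorems/CollisionIsometryCLTCollisionalTransferLocalityMollifiedCeilingConst.lean (private)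
private theorem kf_measure_le_of_subset_on {α : Type*} [MeasurableSpace α] {μ : Measure α}
    {g s t : Set α} (hg : μ gᶜ = 0) (h : ∀ x ∈ g, x ∈ s → x ∈ t) : μ s ≤ μ t :=
  calc μ s ≤ μ (gᶜ ∪ t) := measure_mono fun x hx => by
          by_cases hxg : x ∈ g
          · exact Or.inr (h x hxg hx)
          · exact Or.inl hxg
    _ ≤ μ gᶜ + μ t := measure_union_le _ _
    _ = μ t := by rw [hg, zero_add]

/-! ## The dominating block functional `K(w) = 4 ∫⁻ₓ ofReal A(w, x) + 50 ∫⁻ₓ ofReal B(w, x)` -/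

section Dominators

variable {N : ℕ} {A B : Cfg N → T3 → ℝ}

/-- `w ↦ ∫⁻ₓ ofReal A(w, x)` is measurable for a jointly measurable `A` (Tonelli integrand).
[folklore] -/
private theorem measurable_lintegral_ofReal (hA : Measurable fun p : Cfg N × T3 => A p.1 p.2) :
    Measurable fun w : Cfg N => ∫⁻ x, ENNReal.ofReal (A w x) :=
  hA.ennreal_ofReal.lintegral_prod_right'

/-- `w ↦ K(w)` is measurable. [folklore] -/
private theorem measurable_domK (hA : Measurable fun p : Cfg N × T3 => A p.1 p.2)
    (hB : Measurable fun p : Cfg N × T3 => B p.1 p.2) :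
    Measurable fun w : Cfg N =>
      4 * (∫⁻ x, ENNReal.ofReal (A w x)) + 50 * ∫⁻ x, ENNReal.ofReal (B w x) :=
  ((measurable_lintegral_ofReal hA).const_mul 4).fun_add
    ((measurable_lintegral_ofReal hB).const_mul 50)

/-- `∫⁻ K dμ = 4 ∫⁻ ∫⁻ₓ ofReal A dμ + 50 ∫⁻ ∫⁻ₓ ofReal B dμ`. [folklore] -/
private theorem lintegral_domK (μ : Measure (Cfg N)) (hA : Measurable fun p : Cfg N × T3 => A p.1 p.2)
    (hB : Measurable fun p : Cfg N × T3 => B p.1 p.2) :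
    ∫⁻ z, (4 * (∫⁻ x, ENNReal.ofReal (A z x)) + 50 * ∫⁻ x, ENNReal.ofReal (B z x)) ∂μ =
      4 * ∫⁻ z, (∫⁻ x, ENNReal.ofReal (A z x)) ∂μ +
        50 * ∫⁻ z, (∫⁻ x, ENNReal.ofReal (B z x)) ∂μ := by
  rw [lintegral_add_left ((measurable_lintegral_ofReal hA).const_mul _),
    lintegral_const_mul _ (measurable_lintegral_ofReal hA),
    lintegral_const_mul _ (measurable_lintegral_ofReal hB)]

/-- `∫⁻ₓ ofReal F ≤ K(w)` from the pointwise domination `ofReal F ≤ 4 ofReal A + 50 ofReal B`.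
[folklore] -/
private theorem lintegral_ofReal_le_domK {F : T3 → ℝ}
    (hA : Measurable fun p : Cfg N × T3 => A p.1 p.2)
    (hB : Measurable fun p : Cfg N × T3 => B p.1 p.2) (w : Cfg N)
    (hpt : ∀ x : T3, ENNReal.ofReal (F x) ≤
      4 * ENNReal.ofReal (A w x) + 50 * ENNReal.ofReal (B w x)) :
    ∫⁻ x, ENNReal.ofReal (F x) ≤
      4 * (∫⁻ x, ENNReal.ofReal (A w x)) + 50 * ∫⁻ x, ENNReal.ofReal (B w x) := by
  have h1 : Measurable fun x : T3 => ENNReal.ofReal (A w x) :=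
    (hA.comp (measurable_prodMk_left (x := w))).ennreal_ofReal
  have h2 : Measurable fun x : T3 => ENNReal.ofReal (B w x) :=
    (hB.comp (measurable_prodMk_left (x := w))).ennreal_ofReal
  calc ∫⁻ x, ENNReal.ofReal (F x)
      ≤ ∫⁻ x, (4 * ENNReal.ofReal (A w x) + 50 * ENNReal.ofReal (B w x)) := lintegral_mono hpt
    _ = 4 * (∫⁻ x, ENNReal.ofReal (A w x)) + 50 * ∫⁻ x, ENNReal.ofReal (B w x) := by
        rw [lintegral_add_left (h1.const_mul _), lintegral_const_mul _ h1, lintegral_const_mul _ h2]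

end Dominators

/-! ## Joint measurability of the two dominators -/

section Measurability

variable {θ : ℝ} {φ : ℕ → T3 → ℝ} {N : ℕ}

/-- `(w, x) ↦ A + B = Σ_jk ⟨φ (v_j v_k − θ δ_jk)⟩² + |m̄|² Ē/ρ̄` is measurable for a continuous
kernel. [folklore] -/
private theorem measurable_dom1 (hφc : Continuous (φ N)) :
    Measurable fun p : Cfg N × T3 =>
      (∑ j : Fin 3, ∑ k : Fin 3, (((N : ℝ) + 1)⁻¹ * ∑ i : Fin (N + 1),
        φ N ((p.1 i).1 - p.2) * ((p.1 i).2 j * (p.1 i).2 k - if j = k then θ else 0)) ^ 2) +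
        ‖mB φ N p.1 p.2‖ ^ 2 * (EB φ N p.1 p.2 / rhoB φ N p.1 p.2) := by
  haveI : ∀ _i : Fin (N + 1), BorelSpace (T3 × V3) := fun _ => Prod.borelSpace
  have hA : Continuous fun p : Cfg N × T3 => ∑ j : Fin 3, ∑ k : Fin 3,
      (((N : ℝ) + 1)⁻¹ * ∑ i : Fin (N + 1),
        φ N ((p.1 i).1 - p.2) * ((p.1 i).2 j * (p.1 i).2 k - if j = k then θ else 0)) ^ 2 := by
    fun_prop
  have hm := (continuous_mB (N := N) (φ := φ) hφc).measurable
  have hE := (continuous_EB (N := N) (φ := φ) hφc).measurable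
  have hr := (continuous_rhoB (N := N) (φ := φ) hφc).measurable
  exact hA.measurable.add ((hm.norm.pow_const 2).mul (hE.div hr))

/-- `(w, x) ↦ T + B₂ = Σ_a ⟨φ |v|² v_a⟩² + |m̄|² (Ē/ρ̄)²` is measurable for a continuous kernel.
[folklore] -/
private theorem measurable_dom2 (hφc : Continuous (φ N)) :
    Measurable fun p : Cfg N × T3 =>
      (∑ a : Fin 3, (((N : ℝ) + 1)⁻¹ * ∑ i : Fin (N + 1),
        φ N ((p.1 i).1 - p.2) * (‖(p.1 i).2‖ ^ 2 * (p.1 i).2 a)) ^ 2) +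
        ‖mB φ N p.1 p.2‖ ^ 2 * (EB φ N p.1 p.2 / rhoB φ N p.1 p.2) ^ 2 := by
  haveI : ∀ _i : Fin (N + 1), BorelSpace (T3 × V3) := fun _ => Prod.borelSpace
  have hT : Continuous fun p : Cfg N × T3 => ∑ a : Fin 3,
      (((N : ℝ) + 1)⁻¹ * ∑ i : Fin (N + 1),
        φ N ((p.1 i).1 - p.2) * (‖(p.1 i).2‖ ^ 2 * (p.1 i).2 a)) ^ 2 := by
    fun_prop
  have hm := (continuous_mB (N := N) (φ := φ) hφc).measurable
  have hE := (continuous_EB (N := N) (φ := φ) hφc).measurable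
  have hr := (continuous_rhoB (N := N) (φ := φ) hφc).measurable
  exact hT.measurable.add ((hm.norm.pow_const 2).mul ((hE.div hr).pow_const 2))

end Measurability

/-! ## Markov + Tonelli + stationarity, for one `N` -/

/-- **The one-`N` bound.** For a flow family `Φ`, an s-finite measure `P` on phase space carried
by the good set of `Φ N` and invariant under every flow map `Φ_s` in the `lintegral` sense, and a
measurable `K : Cfg N → ℝ≥0∞` dominating `∫⁻ₓ ofReal (Σ D² + |q|²)(w, x)`:
`P {δ < ∫_{[0,t]} ∫ₓ (Σ D² + |q|²)(Φ_s z, x)} ≤ t · (∫⁻ K dP) / δ` — (i) the real double integral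
is dominated by the iterated lower integral, (ii) which is `≤ ∫⁻_{[0,t]} K(Φ_s z) ds`, on the good
set equal to the measurable `∫⁻_{[0,t]} K(F(s, z)) ds` for the jointly measurable modification
`F` of the flow (`exists_measurable_flow`); (iii) Markov; (iv) Tonelli; (v) invariance. [folklore] -/
private theorem measure_lt_setIntegral_le {σ : ℝ} (Φ : Flows σ) {φ : ℕ → T3 → ℝ} (N : ℕ)
    (P : Measure (Cfg N)) [SFinite P] (hPg : P (Φ N).goodᶜ = 0)
    (hst : ∀ (s : ℝ) (g : Cfg N → ℝ≥0∞), Measurable g →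
      ∫⁻ z, g ((Φ N).flow s z) ∂P = ∫⁻ z, g z ∂P)
    (K : Cfg N → ℝ≥0∞) (hKm : Measurable K)
    (hFK : ∀ w : Cfg N,
      ∫⁻ x, ENNReal.ofReal ((∑ j, ∑ k, Dst φ N w x j k ^ 2) + ‖qfl φ N w x‖ ^ 2) ≤ K w)
    (t : ℝ) {δ : ℝ} (hδ : 0 < δ) :
    P {z | δ < ∫ s in Icc 0 t, ∫ x, ((∑ j, ∑ k, Dst φ N ((Φ N).flow s z) x j k ^ 2) +
        ‖qfl φ N ((Φ N).flow s z) x‖ ^ 2)} ≤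
      ENNReal.ofReal t * (∫⁻ z, K z ∂P) / ENNReal.ofReal δ := by
  obtain ⟨Fm, hFm, hF⟩ := exists_measurable_flow Φ N
  have hgood : ∀ᵐ z ∂P, z ∈ (Φ N).good := ae_iff.2 hPg
  -- the jointly measurable integrand `(s, z) ↦ K(F(s, z))` and the majorant `Y`
  have hKF : Measurable fun q : ℝ × Cfg N => K (Fm q) := hKm.comp hFm
  have hYm : Measurable fun z : Cfg N => ∫⁻ s in Icc 0 t, K (Fm (s, z)) :=
    hKF.lintegral_prod_left'
  have hkin0 : ∀ (w : Cfg N) (x : T3), 0 ≤ (∑ j, ∑ k, Dst φ N w x j k ^ 2) + ‖qfl φ N w x‖ ^ 2 :=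
    fun w x => add_nonneg (Finset.sum_nonneg fun j _ => Finset.sum_nonneg fun k _ => sq_nonneg _)
      (sq_nonneg _)
  -- (i)+(ii): off the bad set the event forces `ofReal δ ≤ Y z`
  have h1 : P {z | δ < ∫ s in Icc 0 t, ∫ x, ((∑ j, ∑ k, Dst φ N ((Φ N).flow s z) x j k ^ 2) +
      ‖qfl φ N ((Φ N).flow s z) x‖ ^ 2)} ≤
      P {z | ENNReal.ofReal δ ≤ ∫⁻ s in Icc 0 t, K (Fm (s, z))} := by
    refine kf_measure_le_of_subset_on hPg fun z hz hzδ => ?_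
    rw [mem_setOf_eq] at hzδ ⊢
    have hF' : ∀ s, Fm (s, z) = (Φ N).flow s z := fun s => hF s z hz
    simp only [hF']
    calc ENNReal.ofReal δ
        ≤ ENNReal.ofReal (∫ s in Icc 0 t, ∫ x, ((∑ j, ∑ k, Dst φ N ((Φ N).flow s z) x j k ^ 2) +
            ‖qfl φ N ((Φ N).flow s z) x‖ ^ 2)) := ENNReal.ofReal_le_ofReal hzδ.le
      _ ≤ ∫⁻ s in Icc 0 t, ENNReal.ofReal (∫ x, ((∑ j, ∑ k, Dst φ N ((Φ N).flow s z) x j k ^ 2) +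
            ‖qfl φ N ((Φ N).flow s z) x‖ ^ 2)) :=
          ofReal_integral_le_lintegral_ofReal_of_nonneg fun s =>
            integral_nonneg fun x => hkin0 _ x
      _ ≤ ∫⁻ s in Icc 0 t, ∫⁻ x, ENNReal.ofReal ((∑ j, ∑ k, Dst φ N ((Φ N).flow s z) x j k ^ 2) +
            ‖qfl φ N ((Φ N).flow s z) x‖ ^ 2) :=
          lintegral_mono fun s => ofReal_integral_le_lintegral_ofReal_of_nonneg fun x => hkin0 _ x
      _ ≤ ∫⁻ s in Icc 0 t, K ((Φ N).flow s z) := lintegral_mono fun s => hFK _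
  -- (iii) Markov
  have h2 : P {z | ENNReal.ofReal δ ≤ ∫⁻ s in Icc 0 t, K (Fm (s, z))} ≤
      (∫⁻ z, (∫⁻ s in Icc 0 t, K (Fm (s, z))) ∂P) / ENNReal.ofReal δ :=
    meas_ge_le_lintegral_div hYm.aemeasurable (ENNReal.ofReal_pos.2 hδ).ne' ENNReal.ofReal_ne_top
  -- (iv) Tonelli, (v) the null modification and stationarity, then a constant in time
  have h3 : ∫⁻ z, (∫⁻ s in Icc 0 t, K (Fm (s, z))) ∂P = ENNReal.ofReal t * ∫⁻ z, K z ∂P := by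
    have hsw : AEMeasurable (uncurry fun (z : Cfg N) (s : ℝ) => K (Fm (s, z)))
        (P.prod (volume.restrict (Icc 0 t))) := (hKF.comp measurable_swap).aemeasurable
    have hs : ∀ s : ℝ, ∫⁻ z, K (Fm (s, z)) ∂P = ∫⁻ z, K z ∂P := fun s =>
      calc ∫⁻ z, K (Fm (s, z)) ∂P = ∫⁻ z, K ((Φ N).flow s z) ∂P :=
            lintegral_congr_ae (hgood.mono fun z hz =>
              show K (Fm (s, z)) = K ((Φ N).flow s z) by rw [hF s z hz])
        _ = ∫⁻ z, K z ∂P := hst s K hKm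
    rw [lintegral_lintegral_swap hsw, lintegral_congr hs, setLIntegral_const, Real.volume_Icc,
      sub_zero, mul_comm]
  calc P {z | δ < ∫ s in Icc 0 t, ∫ x, ((∑ j, ∑ k, Dst φ N ((Φ N).flow s z) x j k ^ 2) +
        ‖qfl φ N ((Φ N).flow s z) x‖ ^ 2)}
      ≤ P {z | ENNReal.ofReal δ ≤ ∫⁻ s in Icc 0 t, K (Fm (s, z))} := h1
    _ ≤ (∫⁻ z, (∫⁻ s in Icc 0 t, K (Fm (s, z))) ∂P) / ENNReal.ofReal δ := h2
    _ = ENNReal.ofReal t * (∫⁻ z, K z ∂P) / ENNReal.ofReal δ := by rw [h3]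

/-! ## The registered stub -/

/-- **[KF-int] FAST MOMENT RELAXATION AT GLOBAL EQUILIBRIUM FROM THE BLOCK DOMINATORS** (registered
glue stub `stub_fmrConst_of_dominators` of the line `hemisphere-affine-slaving`, crux
`CollisionalTransferLocality`, stmt-AtomisticToContinuum-9518; item 9522 `FastMomentRelaxation` at
the constant profiles `(1, 0, θ)` for every flow family). IF, under the homogeneous local Gibbs law
and for every admissible kernel family, the expected lower integrals of the block-stress dominator
`A + B` ([KS-D']) and of the block-heat-flux dominator `T + B₂` ([KS-q']) tend to `0`, and IF the
block kinetic integrand is dominated pointwise, `Σ D² + |q|² ≤ 2A + 4B + T/2 + 50B₂` for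
nonnegative kernels ([KF-dom]), THEN for every `t > 0`, `δ > 0`,
`G_N {z | δ < ∫_{s ∈ [0,t]} ∫ₓ (Σ_jk D_jk² + |q|²)(Φ_s z, x)} → 0`.
Proof: `ofReal` of the (possibly junk) double Bochner integral is below the iterated lower integral
of `ofReal (Σ D² + |q|²) ≤ 4 ofReal (A+B) + 50 ofReal (T+B₂)`; Markov off the null bad set through
the jointly measurable modification of the flow, Tonelli in `(z, s)`, and invariance of the
homogeneous law under every hard-sphere flow (`lintegral_comp_flow_localGibbsLaw_const`) bound the
probability by `t (4 E_N ∫⁻ₓ(A+B) + 50 E_N ∫⁻ₓ(T+B₂)) / δ → 0`. [folklore] -/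
theorem stub_fmrConst_of_dominators : (∀ σ : ℝ, 0 < σ → σ ≤ 1 / 2 → ∀ θ : ℝ, 0 < θ → ∀ (Φ : Flows σ) (γ C : ℝ) (φ : ℕ → T3 → ℝ), 0 < γ → γ ≤ 1 / 15 → AdmissibleKernel γ C φ → Tendsto (fun N : ℕ => ∫⁻ z, (∫⁻ x : T3, ENNReal.ofReal ((∑ j : Fin 3, ∑ k : Fin 3, (((N : ℝ) + 1)⁻¹ * ∑ i : Fin (N + 1), φ N ((z i).1 - x) * ((z i).2 j * (z i).2 k - if j = k then θ else 0)) ^ 2) + ‖mB φ N z x‖ ^ 2 * (EB φ N z x / rhoB φ N z x))) ∂(Literature.MathematicalPhysics.KineticTheory.localGibbsLaw σ (fun _ => 1) (fun _ => 0) (fun _ => θ) N (Φ N))) atTop (𝓝 0)) → (∀ σ : ℝ, 0 < σ → σ ≤ 1 / 2 → ∀ θ : ℝ, 0 < θ → ∀ (Φ : Flows σ) (γ C : ℝ) (φ : ℕ → T3 → ℝ), 0 < γ → γ ≤ 1 / 15 → AdmissibleKernel γ C φ → Tendsto (fun N : ℕ => ∫⁻ z, (∫⁻ x : T3, ENNReal.ofReal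 ((∑ a : Fin 3, (((N : ℝ) + 1)⁻¹ * ∑ i : Fin (N + 1), φ N ((z i).1 - x) * (‖(z i).2‖ ^ 2 * (z i).2 a)) ^ 2) + ‖mB φ N z x‖ ^ 2 * (EB φ N z x / rhoB φ N z x) ^ 2)) ∂(Literature.MathematicalPhysics.KineticTheory.localGibbsLaw σ (fun _ => 1) (fun _ => 0) (fun _ => θ) N (Φ N))) atTop (𝓝 0)) → (∀ (θ : ℝ) (φ : ℕ → T3 → ℝ) (N : ℕ) (z : Cfg N) (x : T3), (∀ y, 0 ≤ φ N y) → (∑ j : Fin 3, ∑ k : Fin 3, Dst φ N z x j k ^ 2) + ‖qfl φ N z x‖ ^ 2 ≤ 2 * (∑ j : Fin 3, ∑ k : Fin 3, (((N : ℝ) + 1)⁻¹ * ∑ i : Fin (N + 1), φ N ((z i).1 - x) * ((z i).2 j * (z i).2 k - if j = k then θ else 0)) ^ 2) + 4 * (‖mB φ N z x‖ ^ 2 * (EB φ N z x / rhoB φ N z x)) + 1 / 2 * (∑ a : Fin 3, (((N : ℝ) + 1)⁻¹ * ∑ i : Fin (N + 1), φ N ((z i).1 - x) * (‖(z i).2‖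 ^ 2 * (z i).2 a)) ^ 2) + 50 * (‖mB φ N z x‖ ^ 2 * (EB φ N z x / rhoB φ N z x) ^ 2)) → ∀ σ : ℝ, 0 < σ → σ ≤ 1 / 2 → ∀ θ : ℝ, 0 < θ → ∀ (Φ : Flows σ) (γ C : ℝ) (φ : ℕ → T3 → ℝ), 0 < γ → γ ≤ 1 / 15 → AdmissibleKernel γ C φ → ∀ t : ℝ, 0 < t → ∀ δ : ℝ, 0 < δ → Tendsto (fun N : ℕ => Literature.MathematicalPhysics.KineticTheory.localGibbsLaw σ (fun _ => 1) (fun _ => 0) (fun _ => θ) N (Φ N) {z | δ < ∫ s in Icc 0 t, ∫ x, ((∑ j, ∑ k, Dst φ N ((Φ N).flow s z) x j k ^ 2) + ‖qfl φ N ((Φ N).flow s z) x‖ ^ 2)}) atTop (𝓝 0) := by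
  intro h₁ h₂ h₃ σ hσ hσ2 θ hθ Φ γ C φ hγ hγ' hadm t _ht δ hδ
  obtain ⟨hsm, hφ0, -, -, -, -⟩ := id hadm
  have hφc : ∀ N, Continuous (φ N) := fun N => (hsm N).continuous
  haveI hPr : ∀ N, IsProbabilityMeasure
      (localGibbsLaw σ (fun _ => 1) (fun _ => 0) (fun _ => θ) N (Φ N)) := fun N =>
    isProbabilityMeasure_localGibbsLaw (a₀ := fun _ => 1) (θ₀ := fun _ => θ) (u₀ := fun _ => 0)
      continuous_const continuous_const continuous_const (fun _ => one_pos) (fun _ => hθ) hσ2 N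
      (Φ N)
  -- the two dominators `A + B` and `T + B₂` as (opaque) functions, and their measurability
  obtain ⟨D₁, hD₁⟩ : ∃ D₁ : (N : ℕ) → Cfg N → T3 → ℝ, ∀ (N : ℕ) (w : Cfg N) (x : T3), D₁ N w x =
      (∑ j : Fin 3, ∑ k : Fin 3, (((N : ℝ) + 1)⁻¹ * ∑ i : Fin (N + 1),
        φ N ((w i).1 - x) * ((w i).2 j * (w i).2 k - if j = k then θ else 0)) ^ 2) +
        ‖mB φ N w x‖ ^ 2 * (EB φ N w x / rhoB φ N w x) := ⟨_, fun _ _ _ => rfl⟩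
  obtain ⟨D₂, hD₂⟩ : ∃ D₂ : (N : ℕ) → Cfg N → T3 → ℝ, ∀ (N : ℕ) (w : Cfg N) (x : T3), D₂ N w x =
      (∑ a : Fin 3, (((N : ℝ) + 1)⁻¹ * ∑ i : Fin (N + 1),
        φ N ((w i).1 - x) * (‖(w i).2‖ ^ 2 * (w i).2 a)) ^ 2) +
        ‖mB φ N w x‖ ^ 2 * (EB φ N w x / rhoB φ N w x) ^ 2 := ⟨_, fun _ _ _ => rfl⟩
  have hD₁m : ∀ N, Measurable fun p : Cfg N × T3 => D₁ N p.1 p.2 := fun N => by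
    simpa only [hD₁] using measurable_dom1 (θ := θ) (hφc N)
  have hD₂m : ∀ N, Measurable fun p : Cfg N × T3 => D₂ N p.1 p.2 := fun N => by
    simpa only [hD₂] using measurable_dom2 (hφc N)
  -- [KF-dom] in `ℝ≥0∞`: `ofReal (Σ D² + |q|²) ≤ 4 ofReal (A + B) + 50 ofReal (T + B₂)`
  have hpt : ∀ (N : ℕ) (w : Cfg N) (x : T3),
      ENNReal.ofReal ((∑ j, ∑ k, Dst φ N w x j k ^ 2) + ‖qfl φ N w x‖ ^ 2) ≤
        4 * ENNReal.ofReal (D₁ N w x) + 50 * ENNReal.ofReal (D₂ N w x) := by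
    intro N w x
    rw [hD₁, hD₂]
    exact ofReal_le_of_dominators (h₃ θ φ N w x (hφ0 N))
      (Finset.sum_nonneg fun j _ => Finset.sum_nonneg fun k _ => sq_nonneg _)
      (Finset.sum_nonneg fun a _ => sq_nonneg _)
  -- [KS-D'], [KS-q'] at this `(σ, θ, Φ, kernel)`
  have hI1 : Tendsto (fun N : ℕ => ∫⁻ z, (∫⁻ x, ENNReal.ofReal (D₁ N z x))
      ∂(localGibbsLaw σ (fun _ => 1) (fun _ => 0) (fun _ => θ) N (Φ N))) atTop (𝓝 0) := by
    simpa only [hD₁] using h₁ σ hσ hσ2 θ hθ Φ γ C φ hγ hγ' hadm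
  have hI2 : Tendsto (fun N : ℕ => ∫⁻ z, (∫⁻ x, ENNReal.ofReal (D₂ N z x))
      ∂(localGibbsLaw σ (fun _ => 1) (fun _ => 0) (fun _ => θ) N (Φ N))) atTop (𝓝 0) := by
    simpa only [hD₂] using h₂ σ hσ hσ2 θ hθ Φ γ C φ hγ hγ' hadm
  -- hence `E_N K → 0` and the Markov bound `t E_N K / δ → 0`
  have hK : Tendsto (fun N : ℕ => ∫⁻ z, (4 * (∫⁻ x, ENNReal.ofReal (D₁ N z x)) +
      50 * ∫⁻ x, ENNReal.ofReal (D₂ N z x))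
      ∂(localGibbsLaw σ (fun _ => 1) (fun _ => 0) (fun _ => θ) N (Φ N))) atTop (𝓝 0) := by
    have h := (ENNReal.Tendsto.const_mul (a := 4) hI1 (Or.inr ENNReal.ofNat_ne_top)).add
      (ENNReal.Tendsto.const_mul (a := 50) hI2 (Or.inr ENNReal.ofNat_ne_top))
    simp only [mul_zero, add_zero] at h
    exact h.congr fun N => (lintegral_domK _ (hD₁m N) (hD₂m N)).symm
  have hfin : Tendsto (fun N : ℕ => ENNReal.ofReal t * (∫⁻ z, (4 * (∫⁻ x, ENNReal.ofReal (D₁ N z x)) +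
      50 * ∫⁻ x, ENNReal.ofReal (D₂ N z x))
      ∂(localGibbsLaw σ (fun _ => 1) (fun _ => 0) (fun _ => θ) N (Φ N))) / ENNReal.ofReal δ)
      atTop (𝓝 0) := by
    have h := ENNReal.Tendsto.div_const (b := ENNReal.ofReal δ)
      (ENNReal.Tendsto.const_mul (a := ENNReal.ofReal t) hK (Or.inr ENNReal.ofReal_ne_top))
      (Or.inr (ENNReal.ofReal_pos.2 hδ).ne')
    simpa only [mul_zero, ENNReal.zero_div] using h
  -- the one-`N` bound and the squeeze
  have hbound : ∀ N : ℕ, localGibbsLaw σ (fun _ => 1) (fun _ => 0) (fun _ => θ) N (Φ N)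
      {z | δ < ∫ s in Icc 0 t, ∫ x, ((∑ j, ∑ k, Dst φ N ((Φ N).flow s z) x j k ^ 2) +
        ‖qfl φ N ((Φ N).flow s z) x‖ ^ 2)} ≤
      ENNReal.ofReal t * (∫⁻ z, (4 * (∫⁻ x, ENNReal.ofReal (D₁ N z x)) +
        50 * ∫⁻ x, ENNReal.ofReal (D₂ N z x))
        ∂(localGibbsLaw σ (fun _ => 1) (fun _ => 0) (fun _ => θ) N (Φ N))) / ENNReal.ofReal δ :=
    fun N => measure_lt_setIntegral_le Φ N
      (localGibbsLaw σ (fun _ => 1) (fun _ => 0) (fun _ => θ) N (Φ N))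
      (localGibbsLaw_compl_good' (Φ N))
      (fun s g hg => lintegral_comp_flow_localGibbsLaw_const σ 1 θ 0 N (Φ N) s hg)
      (fun w => 4 * (∫⁻ x, ENNReal.ofReal (D₁ N w x)) + 50 * ∫⁻ x, ENNReal.ofReal (D₂ N w x))
      (measurable_domK (hD₁m N) (hD₂m N))
      (fun w => lintegral_ofReal_le_domK (hD₁m N) (hD₂m N) w (hpt N w)) t hδ
  exact tendsto_of_tendsto_of_tendsto_of_le_of_le tendsto_const_nhds hfin (fun N => zero_le)
    hbound

end

end Summit.AtomisticToContinuum.HydrodynamicLimit.Theorems.HemisphereAffineSlaving
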